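import Summits.ResolutionOfSingularities.ResolutionOfSingularities.Theorems.FrobeniusClosingPatchingRelPerfectDepthLegalMoveStep
import Summits.ResolutionOfSingularities.ResolutionOfSingularities.Theorems.FrobeniusClosingPatchingRelPerfectDepthLegalMeasure
import Summits.ResolutionOfSingularities.ResolutionOfSingularities.Theorems.FrobeniusClosingPatchingRelPerfectDepthWeightedCleanupSNC
import Summits.ResolutionOfSingularities.ResolutionOfSingularities.Theorems.FrobeniusClosingPatchingRelPerfectDepthLegalPositive
import Literature.AlgebraicGeometry.Resolution.BlowupsIntegral
import Literature.AlgebraicGeometry.Resolution.NormalCrossingsStrictification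
import Literature.AlgebraicGeometry.Resolution.ResolutionOfComponentsRegularLocus
import HarnessLib

/-!
# Crux `PatchingRelPerfect` (stmt-ResolutionOfSingularities-16161), chain W5.2 — T6-E1b residual `LegalScopedDivisorReduction₃`,
# PHASE 2 closer (2b), spec D2: the CURVE-MOVE LOOP on one integral host component, generic in the curve-choosing ORACLE (spec D4)

[OURS · L1 W5.2 · res-L1-w52-lead-1 g5, hand #3b; spec `L/res-L1-w52-lead-1/PHASE2-STEPB-SPEC.md` D2] Replaces the role of NO printed item;
NOT a statement of the manuscript under review; fact-free.

STEP B of the separation game on ONE integral host component `X = V(D)`: as long as the trace `T = M|_X` of the positive boundary is not the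
unit ideal, an ORACLE (spec D4 — the geometric part, supplied by the caller as a hypothesis together with its own invariant `Inv`) names a
codimension-one point `ζ` of the trace whose curve `cl{ι ζ}` is a regular subscheme having normal crossings with the boundary; the move
`HostStateN.curve_move` (…DepthLegalMoveStep) is then weight-two legal, keeps the state shape, and lowers the total trace degree
`Φ = Σ_{divisorialPoints T} ord` by at least one (`measure_drop`, …DepthLegalMeasure). Hence:

* `curve_loop` — from any `HostStateN` with integral active host, `Inv`, inert factor disjoint from the host and non-zero trace, a PURE
  WEIGHT-TWO sequence reaches a `HostStateN` with integral host, `Inv`, disjoint inert factor and TRIVIAL trace `M′|_{X′} = ⊤` (the host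
  component no longer meets the positive boundary) — on an integral Noetherian scheme again.

AI-written; AI review is weaker than expert review.

## References
* J. Kollár, *Lectures on Resolution of Singularities* (2007), 3.30.2. [Kollar2007]
* V. Cossart, O. Piltant, J. Algebra 320 (2008), proof of Prop. 4.2. [CossartPiltant2008]
-/

-- `Summit.<Summit>.<Sub>.Theorems` with `Sub = Summit` (single-conjunct summit, D-0017)
set_option linter.dupNamespace false

noncomputable section

open CategoryTheory CategoryTheory.Limits AlgebraicGeometry TopologicalSpace IsLocalRing
open Literature.AlgebraicGeometry.Resolution Scheme.IdealSheafData

namespace Summit.ResolutionOfSingularities.ResolutionOfSingularities.Theorems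

universe u

namespace DepthLegal

open WeightTwoB DepthTargets

/-- The shape of the curve-choosing ORACLE of spec D4: at a state with non-trivial non-zero trace it names a codimension-one point of the
trace whose curve is a regular subscheme normal crossings with the boundary, and re-establishes the invariant after the move along it. -/
def CurveOracle (Inv : ∀ {E : Scheme.{u}}, E.IdealSheafData → E.IdealSheafData → E.IdealSheafData →
    List (E.IdealSheafData × ℕ) → Prop) : Prop :=
  ∀ {E : Scheme.{u}} [IsIntegral E] [IsNoetherian E] {H N D : E.IdealSheafData} {L : List (E.IdealSheafData × ℕ)},
    HostStateN H N D L → IsIntegral D.subscheme → (∀ p ∈ L, 0 < p.2) → Inv H N D L →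
    (monomialIdeal L).comap D.subschemeι ≠ ⊥ → (monomialIdeal L).comap D.subschemeι ≠ ⊤ →
    ∃ ζ : D.subscheme, Order.coheight ζ = 1 ∧ ζ ∈ ((monomialIdeal L).comap D.subschemeι).support ∧
      Scheme.IsRegular (vanishingIdeal ⟨closure {D.subschemeι ζ}, isClosed_closure⟩).subscheme ∧
      HasSNCWith (boundaryOf L) (vanishingIdeal ⟨closure {D.subschemeι ζ}, isClosed_closure⟩) ∧
      Inv (controlledTransform (blowup.π (vanishingIdeal ⟨closure {D.subschemeι ζ}, isClosed_closure⟩))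
            (vanishingIdeal ⟨closure {D.subschemeι ζ}, isClosed_closure⟩) H 2)
          (N.comap (blowup.π (vanishingIdeal ⟨closure {D.subschemeι ζ}, isClosed_closure⟩)))
          (controlledTransform (blowup.π (vanishingIdeal ⟨closure {D.subschemeι ζ}, isClosed_closure⟩))
            (vanishingIdeal ⟨closure {D.subschemeι ζ}, isClosed_closure⟩) D 1)
          ((stepExp L (blowup.π (vanishingIdeal ⟨closure {D.subschemeι ζ}, isClosed_closure⟩))
            (vanishingIdeal ⟨closure {D.subschemeι ζ}, isClosed_closure⟩) (weightAt L (D.subschemeι ζ) - 1)).filter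
              fun p => decide (0 < p.2))

/-- The game runs on the positive part of the boundary list (res-L1-w52-idea-1 O4.1, `HostState.filter_pos`), with an inert factor. -/
theorem HostStateN.filter_pos {E : Scheme.{u}} [IsLocallyNoetherian E] {H N D : E.IdealSheafData}
    {L : List (E.IdealSheafData × ℕ)} (S : HostStateN H N D L) : HostStateN H N D (L.filter fun p => decide (0 < p.2)) where
  regE := S.regE
  fac := by rw [DepthSNC.monomialIdeal_filter_pos]; exact S.fac
  hostCartier := S.hostCartier
  hostHyp := S.hostHyp
  sncB := HasSNCWith.sublist (boundaryOf_filter_sublist L _) S.sncB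

/-- [OURS · L1 W5.2] **THE CURVE-MOVE LOOP (STEP B on one integral host component).** See the module docstring.
[cite: Kollar2007, 3.30.2] [cite: CossartPiltant2008, proof of Prop. 4.2] -/
theorem curve_loop
    (Inv : ∀ {E : Scheme.{u}}, E.IdealSheafData → E.IdealSheafData → E.IdealSheafData → List (E.IdealSheafData × ℕ) → Prop)
    (horacle : CurveOracle Inv) (n : ℕ) :
    ∀ {E : Scheme.{u}} [IsIntegral E] [IsNoetherian E] {H N D : E.IdealSheafData} {L : List (E.IdealSheafData × ℕ)}
      (_ : HostStateN H N D L) (_ : IsIntegral D.subscheme), (∀ p ∈ L, 0 < p.2) → Inv H N D L →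
      Disjoint (N.support : Set E) D.support →
      (monomialIdeal L).comap D.subschemeι ≠ ⊥ →
      (∀ hfin : (divisorialPoints ((monomialIdeal L).comap D.subschemeι)).Finite,
          (∑ y ∈ hfin.toFinset, (idealOrder ((monomialIdeal L).comap D.subschemeι) y).toNat) ≤ n) →
      ∃ (E' : Scheme.{u}) (_ : IsIntegral E') (hN' : IsNoetherian E') (ρ : E' ⟶ E) (H' N' D' : E'.IdealSheafData)
        (L' : List (E'.IdealSheafData × ℕ)),
        IsPureWeightedSeq 2 ρ H H' ∧ @HostStateN E' hN'.toIsLocallyNoetherian H' N' D' L' ∧ IsIntegral D'.subscheme ∧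
          (∀ p ∈ L', 0 < p.2) ∧ Inv H' N' D' L' ∧ Disjoint (N'.support : Set E') D'.support ∧
          (monomialIdeal L').comap D'.subschemeι = ⊤ := by
  induction n with
  | zero =>
    intro E _ _ H N D L S hXint hpos hInv hdisj hT hΦ
    by_cases htop : (monomialIdeal L).comap D.subschemeι = ⊤
    · exact ⟨E, ‹_›, ‹_›, 𝟙 E, H, N, D, L, IsPureWeightedSeq.nil H, S, hXint, hpos, hInv, hdisj, htop⟩
    -- otherwise the oracle exhibits a divisorial point, whose order is positive: the measure is not `0`
    exfalso
    haveI := hXint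
    haveI : IsNoetherian D.subscheme := isNoetherian_subscheme D
    obtain ⟨ζ, hζ, hζT, -, -, -⟩ := horacle S hXint hpos hInv hT htop
    have hfin := finite_divisorialPoints hT
    have hle := hΦ hfin
    have hmem : ζ ∈ hfin.toFinset := by rw [Set.Finite.mem_toFinset]; exact ⟨hζT, hζ⟩
    have hpos : 1 ≤ (idealOrder ((monomialIdeal L).comap D.subschemeι) ζ).toNat := by
      obtain ⟨b, hb⟩ := exists_idealOrder_eq_natCast hT ζ
      have h1 : (1 : ℕ∞) ≤ idealOrder ((monomialIdeal L).comap D.subschemeι) ζ := (one_le_idealOrder_iff _ ζ).mpr hζT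
      rw [hb] at h1 ⊢
      simp only [ENat.toNat_coe]
      exact_mod_cast h1
    have := Finset.single_le_sum (f := fun y => (idealOrder ((monomialIdeal L).comap D.subschemeι) y).toNat)
      (fun _ _ => Nat.zero_le _) hmem
    omega
  | succ n ih =>
    intro E _ _ H N D L S hXint hpos hInv hdisj hT hΦ
    by_cases htop : (monomialIdeal L).comap D.subschemeι = ⊤
    · exact ⟨E, ‹_›, ‹_›, 𝟙 E, H, N, D, L, IsPureWeightedSeq.nil H, S, hXint, hpos, hInv, hdisj, htop⟩
    haveI := hXint
    haveI : IsNoetherian D.subscheme := isNoetherian_subscheme D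
    obtain ⟨ζ, hζ, hζT, hZ, hnc, hInv'⟩ := horacle S hXint hpos hInv hT htop
    -- the centre and the move
    have hτ : IsBlowup (blowup.π (vanishingIdeal (⟨closure {D.subschemeι ζ}, isClosed_closure⟩ : Closeds E)))
        (vanishingIdeal (⟨closure {D.subschemeι ζ}, isClosed_closure⟩ : Closeds E)) := blowup.isBlowup _
    have hZX : ((⟨closure {D.subschemeι ζ}, isClosed_closure⟩ : Closeds E) : Set E) ⊆ D.support :=
      closure_minimal (Set.singleton_subset_iff.mpr (subschemeι_apply_mem_support D ζ)) D.support.isClosed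
    have hζM : D.subschemeι ζ ∈ (monomialIdeal L).support :=
      (mem_support_comap_iff D.subschemeι (monomialIdeal L) ζ).mp hζT
    have hZM : ((⟨closure {D.subschemeι ζ}, isClosed_closure⟩ : Closeds E) : Set E) ⊆ (monomialIdeal L).support :=
      closure_minimal (Set.singleton_subset_iff.mpr hζM) (monomialIdeal L).support.isClosed
    obtain ⟨πX, hπX, hbl, hiso, S', hint', hT'ne, -, hfac, hself, hne⟩ := S.curve_move ζ hζ hζT hT hZ hnc
    -- abbreviate the centre
    generalize hZc : (⟨closure {D.subschemeι ζ}, isClosed_closure⟩ : Closeds E) = Zc at *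
    -- the blown-up ambient is integral and Noetherian
    have hDne : D ≠ ⊥ := by
      intro h0
      obtain ⟨v, hv, hv2⟩ := S.hostHyp _ (subschemeι_apply_mem_support D ζ)
      have hv0 : ∀ (D₀ : E.IdealSheafData) (x : E) (v₀ : E.presheaf.stalk x), D₀ = ⊥ →
          stalkIdeal D₀ x = Ideal.span {v₀} → v₀ = 0 := by
        intro D₀ x v₀ h h'
        subst h
        rw [stalkIdeal_bot] at h'
        simpa using (Ideal.span_singleton_eq_bot.mp h'.symm)
      exact hv2 ((hv0 D _ v h0 hv) ▸ Ideal.zero_mem _)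
    have hCne : vanishingIdeal Zc ≠ ⊥ := fun h0 => hDne (le_bot_iff.mp (h0 ▸ HostState.host_le hZX))
    haveI : IsIntegral (blowup (vanishingIdeal Zc)) := hτ.isIntegral hCne
    haveI hN₁ : IsNoetherian (blowup (vanishingIdeal Zc)) := isNoetherian_of_isBlowup hτ
    haveI := hint'
    haveI : IsNoetherian (controlledTransform (blowup.π (vanishingIdeal Zc)) (vanishingIdeal Zc) D 1).subscheme :=
      isNoetherian_subscheme _
    haveI := hiso
    -- the measure drops
    have hsupp : ∀ y', y' ∈ ((monomialIdeal (stepExp L (blowup.π (vanishingIdeal Zc)) (vanishingIdeal Zc)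
        (weightAt L (D.subschemeι ζ) - 1))).comap
        (controlledTransform (blowup.π (vanishingIdeal Zc)) (vanishingIdeal Zc) D 1).subschemeι).support →
        πX y' ∈ ((monomialIdeal L).comap D.subschemeι).support := by
      intro y' hy'
      have h1 := support_antitone (HostStateN.mul_le_of_inert ((primeDivisorIdeal ζ).comap πX) _) hy'
      rw [← hfac] at h1
      exact (mem_support_comap_iff πX _ y').mp h1
    have hdrop := measure_drop πX πX.isOpenEmbedding.injective hT hT'ne ⟨hζT, hζ⟩ hsupp hself hne
    have hΦ' : ∀ hfin : (divisorialPoints ((monomialIdeal (stepExp L (blowup.π (vanishingIdeal Zc)) (vanishingIdeal Zc)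
        (weightAt L (D.subschemeι ζ) - 1))).comap
        (controlledTransform (blowup.π (vanishingIdeal Zc)) (vanishingIdeal Zc) D 1).subschemeι)).Finite,
        (∑ y ∈ hfin.toFinset, (idealOrder ((monomialIdeal (stepExp L (blowup.π (vanishingIdeal Zc)) (vanishingIdeal Zc)
          (weightAt L (D.subschemeι ζ) - 1))).comap
          (controlledTransform (blowup.π (vanishingIdeal Zc)) (vanishingIdeal Zc) D 1).subschemeι) y).toNat) ≤ n := by
      intro hfin
      have h1 := hΦ (finite_divisorialPoints hT)
      have h2 : hfin.toFinset = (finite_divisorialPoints hT'ne).toFinset := rfl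
      rw [h2]
      omega
    -- recurse on the PRUNED state (exponent-zero members dropped; same host, same monomial, same trace)
    have hmono : monomialIdeal ((stepExp L (blowup.π (vanishingIdeal Zc)) (vanishingIdeal Zc)
        (weightAt L (D.subschemeι ζ) - 1)).filter fun p => decide (0 < p.2)) =
        monomialIdeal (stepExp L (blowup.π (vanishingIdeal Zc)) (vanishingIdeal Zc) (weightAt L (D.subschemeι ζ) - 1)) :=
      DepthSNC.monomialIdeal_filter_pos _
    have hT''ne : (monomialIdeal ((stepExp L (blowup.π (vanishingIdeal Zc)) (vanishingIdeal Zc)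
        (weightAt L (D.subschemeι ζ) - 1)).filter fun p => decide (0 < p.2))).comap
        (controlledTransform (blowup.π (vanishingIdeal Zc)) (vanishingIdeal Zc) D 1).subschemeι ≠ ⊥ := by
      rw [hmono]; exact hT'ne
    have hΦ'' : ∀ hfin : (divisorialPoints ((monomialIdeal ((stepExp L (blowup.π (vanishingIdeal Zc)) (vanishingIdeal Zc)
        (weightAt L (D.subschemeι ζ) - 1)).filter fun p => decide (0 < p.2))).comap
        (controlledTransform (blowup.π (vanishingIdeal Zc)) (vanishingIdeal Zc) D 1).subschemeι)).Finite,
        (∑ y ∈ hfin.toFinset, (idealOrder ((monomialIdeal ((stepExp L (blowup.π (vanishingIdeal Zc)) (vanishingIdeal Zc)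
          (weightAt L (D.subschemeι ζ) - 1)).filter fun p => decide (0 < p.2))).comap
          (controlledTransform (blowup.π (vanishingIdeal Zc)) (vanishingIdeal Zc) D 1).subschemeι) y).toNat) ≤ n := by
      rw [hmono]; exact hΦ'
    obtain ⟨E₂, hI₂, hN₂, ρ₂, H₂, N₂, D₂, L₂, hseq₂, S₂, hint₂, hpos₂, hInv₂, hdisj₂, htop₂⟩ :=
      ih S'.filter_pos hint' (fun p hp => pos_of_mem_filter_pos hp) hInv' (HostStateN.disjoint_step hdisj) hT''ne hΦ''
    refine ⟨E₂, hI₂, hN₂, ρ₂ ≫ blowup.π (vanishingIdeal Zc), H₂, N₂, D₂, L₂, ?_, S₂, hint₂, hpos₂, hInv₂, hdisj₂,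
      htop₂⟩
    -- the pure sequence: one move, then the rest
    have hle : H ≤ vanishingIdeal Zc ^ 2 := (S.le_mul_sq hZX hZM).trans (HostStateN.mul_le_of_inert _ _)
    have h1 : IsPureWeightedSeq 2 (blowup.π (vanishingIdeal Zc)) H
        (controlledTransform (blowup.π (vanishingIdeal Zc)) (vanishingIdeal Zc) H 2) := by
      have h := IsPureWeightedSeq.cons (blowup.π (vanishingIdeal Zc)) (𝟙 E) H H _ (vanishingIdeal Zc)
        (IsPureWeightedSeq.nil H) hZ hle hτ (hτ.comap_eq_pow_mul_controlledTransform_of_le_pow hle)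
      simpa only [Category.comp_id] using h
    exact DepthCleanup.pureWeightedSeq_append hseq₂ h1

end DepthLegal

end Summit.ResolutionOfSingularities.ResolutionOfSingularities.Theorems

end
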